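import Summits.ResolutionOfSingularities.ResolutionOfSingularities.Theorems.FrobeniusLadderFInjectiveMacaulayficationF108ConsumableHolds
import Summits.ResolutionOfSingularities.ResolutionOfSingularities.Theorems.FrobeniusLadderFInjectiveMacaulayficationBrieskornPhamMultiChart
import Summits.ResolutionOfSingularities.ResolutionOfSingularities.Theorems.FrobeniusLadderFInjectiveMacaulayficationDiagonalSqRowOfF108
import HarnessLib

/-!
# THE CONVENIENT WEAKLY-NON-DEGENERATE CLASS ROW, NOW UNCONDITIONAL: with res-L1-toric-fan's ✓p687854 `F108ClassRow.F108Consumable_holds` the named hypothesis of ✓p680734 is a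
# kernel theorem, so — for `k = k̄` of ANY characteristic `p` — every prime CONVENIENT WEAKLY NON-DEGENERATE isolated `f` has its POINT FLOOR CURED, its germ F-injectivised, and the
# Brieskorn–Pham / diagonal families and BED W (class route) are UNCONDITIONAL rows
# (crux `FInjectiveMacaulayfication` stmt-ResolutionOfSingularities-15315, chain w45a; res-L1-toric-fan g0 LANDED line 01:59Z «CONSUMERS: replace the hypothesis (hF : F108Consumable k n) by
# F108ClassRow.F108Consumable_holds k n in …»; seat res-L1-w45a-stub-1 g14)

[OURS · L1 W4.5a] Support file (`--supports stmt-ResolutionOfSingularities-15315 --as helper`); def-free; UNCONDITIONAL (no named hypothesis left: `F108Consumable_holds` is ✓p687854, axioms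
standard; the RELATIVE interface `F108ConsumableRel` of ✓p685336 is NOT discharged here and the monomial-floor / transport theorems stay conditional). HONEST BILLING: class-level ONE-STOREY
point-floor cures for the convenient-WND class over algebraically closed fields — evidence for nothing about beds outside the class (BED D type) or about non-point floors (GAP-1);
nothing of the crux `FInjectiveMacaulayfication` (all reduced separated finite-type X) is proved. AI-written (AI review is weaker than expert review).

* §1 (the hF-free point-floor theorems `fHalfRow_of_convenient` / `pointFloorRow_of_convenient` / `…_of_ringEquiv` are res-L1-toric-fan's ✓ `…F108ClassRowUnconditional`; not restated)
  ★★ `fInjectivizationGermAt_convenientWND` (the germ form `FInjectivizationGermAt p v` — the F-half at the trivial input — for every bed of the class).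
* §2 the families, hF-free: ★★ `brieskornPhamRow` (two-floor, `a₀` minimal), `brieskornPhamRow_fiveFloor` (no ordering), `diagonalRow` (`a` odd `≥ 5`, `2, a ≠ 0`), `diagonalRow_allP`
  (every `p`, `p = 2` included), and ★ `bedW_row_classRoute` (BED W over `k̄` of characteristic 3 through the class route — a second, fan-free-in-the-statement proof of ✓p660468's cure).
[cite: IshiiSingularities2018, Thm. 4.4.23; Fedder1983, Thm. 1.12; GortzWedhorn2020, Prop. 13.91 (2)]
-/

-- single-problem summit: the doubled namespace component is forced
set_option linter.dupNamespace false

noncomputable section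

namespace Summit.ResolutionOfSingularities.ResolutionOfSingularities.Theorems.FInjectiveMacaulayfication.F108Unconditional

open CategoryTheory CategoryTheory.Limits AlgebraicGeometry TopologicalSpace IsLocalRing MvPolynomial
open Literature.AlgebraicGeometry.Resolution Literature.AlgebraicGeometry.Resolution.BoubakriGreuelMarkwig
open Summit.ResolutionOfSingularities.ResolutionOfSingularities.Theorems.FInjectiveMacaulayfication
open SliceableCentre GermForm GermOfGlobalBlowup F108ClassRow

variable (k : Type) [Field k] {n : ℕ}

/-! ## §1 The class row, unconditional -/

/- The hF-free point-floor CURED / two-sided ROW theorems themselves are res-L1-toric-fan's ✓ `F108ClassRow.fHalfRow_of_convenient` / `pointFloorRow_of_convenient` /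
`pointFloorRow_of_convenient_of_ringEquiv` (file `…F108ClassRowUnconditional`); this file adds the germ form and the families. -/

/-- ★★ **THE GERM FORM AT CLASS LEVEL, UNCONDITIONAL**: `FInjectivizationGermAt p v` at the vertex of every bed of the class — the F-half's ∃-conclusion at the trivial input `I = ⊤`, witnessed
by the `𝔪`-primary monomial centre `(x^A)` of ✓p680734 §2 whose affine blow-up is FULL at every point. [OURS · unconditional class theorem; cite: GortzWedhorn2020, Prop. 13.91 (2)] -/
theorem fInjectivizationGermAt_convenientWND (p : ℕ) [Fact p.Prime] [IsAlgClosed k] [CharP k p] (hn : 0 < n)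
    (f : MvPolynomial (Fin n) k) (hfp : Prime f) (hconv : ∀ j : Fin n, ∃ N : ℕ, 0 < N ∧ MvPolynomial.coeff (Finsupp.single j N) f ≠ 0)
    (hWND : ∀ w : Fin n → ℝ, (∀ i, 0 < w i) → IsWeaklyNondegenerateAlong w (f : MvPowerSeries (Fin n) k))
    (hXne : ∀ v : Fin n, Ideal.Quotient.mk (Ideal.span {f}) (X v) ≠ 0)
    (hreg : ∀ x : Spec (.of (MvPolynomial (Fin n) k ⧸ Ideal.span {f})),
      ¬ Ideal.span (Set.range fun j : Fin n => Ideal.Quotient.mk (Ideal.span {f}) (X j)) ≤ x.asIdeal → IsRegularLocalRing (Localization.AtPrime x.asIdeal))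
    (v : Spec (.of (MvPolynomial (Fin n) k ⧸ Ideal.span {f})))
    (hvm : v.asIdeal = Ideal.span (Set.range fun j : Fin n => Ideal.Quotient.mk (Ideal.span {f}) (X j))) :
    FInjectivizationGermAt p v := by
  haveI hfprime : (Ideal.span {f}).IsPrime := (Ideal.span_singleton_prime hfp.ne_zero).mpr hfp
  haveI : IsDomain (MvPolynomial (Fin n) k ⧸ Ideal.span {f}) := Ideal.Quotient.isDomain _
  obtain ⟨A, hprim, hfull⟩ := affineBlowup_fullCl_of_F108Consumable k p (F108Consumable_holds k n) f hfp hconv hWND hXne hreg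
  have hmono : ∀ e : Fin n →₀ ℕ, Ideal.Quotient.mk (Ideal.span {f}) (monomial e (1 : k)) ≠ 0 := fun e =>
    CIConeFiModelCore.mk_monomial_ne_zero (Ideal.span {f}) hXne e
  have hI : Ideal.span ((fun e : Fin n →₀ ℕ => Ideal.Quotient.mk (Ideal.span {f}) (monomial e (1 : k))) '' (A : Set (Fin n →₀ ℕ))) ≠ ⊥ := by
    intro h0
    obtain ⟨N, hN⟩ := hprim ⟨0, hn⟩ (Finset.mem_univ _)
    exact hmono _ ((Submodule.eq_bot_iff _).mp h0 _ (Ideal.subset_span ⟨_, hN, rfl⟩))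
  have hvA : v.asIdeal ≤ (Ideal.span ((fun e : Fin n →₀ ℕ => Ideal.Quotient.mk (Ideal.span {f}) (monomial e (1 : k))) '' (A : Set (Fin n →₀ ℕ)))).radical := by
    rw [hvm, Ideal.span_le]
    rintro _ ⟨j, rfl⟩
    obtain ⟨N, hN⟩ := hprim j (Finset.mem_univ _)
    exact ⟨N, by rw [← map_pow, X_pow_eq_monomial]; exact Ideal.subset_span ⟨_, hN, rfl⟩⟩
  exact fInjectivizationGermAt_of_affineBlowup p _ hI v hvA hfull

/-! ## §2 The families and BED W, unconditional -/

/-- ★★ **THE BRIESKORN–PHAM ROW, UNCONDITIONAL** (`k = k̄`, char `p`; `2 ≤ c < a₀ ≤ a_j`, `a_j ≠ 0` in `k`, `c` free; floor inequality `⌊(p−1)/c⌋ + ⌊(p−1)/(a₀−c)⌋ < p−1`):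
LEGAL ∧ NOT FULL ∧ CURED for every blowing up of `Spec 𝒪_{X,v}` along the point floor of `X = V(z^c + x^{a₀} + y^{a₁} + u^{a₂} + t^{a₃})`. (✓p683460 with `F108Consumable_holds`.)
[OURS · unconditional; cite: IshiiSingularities2018, Thm. 4.4.23; Fedder1983, Thm. 1.12] -/
theorem brieskornPhamRow (p : ℕ) [Fact p.Prime] [IsAlgClosed k] [CharP k p]
    (c a₀ a₁ a₂ a₃ : ℕ) (hc : 2 ≤ c) (h₀ : c < a₀) (h₀₁ : a₀ ≤ a₁) (h₀₂ : a₀ ≤ a₂) (h₀₃ : a₀ ≤ a₃)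
    (ha₀ : ((a₀ : ℕ) : k) ≠ 0) (ha₁ : ((a₁ : ℕ) : k) ≠ 0) (ha₂ : ((a₂ : ℕ) : k) ≠ 0) (ha₃ : ((a₃ : ℕ) : k) ≠ 0) (hab : (p - 1) / c + (p - 1) / (a₀ - c) < p - 1)
    (f : MvPolynomial (Fin 5) k) (hf : f = X 4 ^ c + X 0 ^ a₀ + X 1 ^ a₁ + X 2 ^ a₂ + X 3 ^ a₃)
    (v : Spec (.of (MvPolynomial (Fin 5) k ⧸ Ideal.span {f})))
    (hv : v.asIdeal = Ideal.span (Set.range (fun j : Fin 5 => Ideal.Quotient.mk (Ideal.span {f}) (X j))))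
    (S' : Scheme.{0}) (g : S' ⟶ Spec ((Spec (.of (MvPolynomial (Fin 5) k ⧸ Ideal.span {f}))).presheaf.stalk v))
    (hg : IsBlowup g ((affineBlowup.idealSheaf (Ideal.span (Set.range (fun j : Fin 5 => Ideal.Quotient.mk (Ideal.span {f}) (X j))))).comap ((Spec (.of (MvPolynomial (Fin 5) k ⧸ Ideal.span {f}))).fromSpecStalk v))) :
    (((affineBlowup.idealSheaf (Ideal.span (Set.range fun j : Fin 5 => Ideal.Quotient.mk (Ideal.span {f}) (X j)))).comap
        ((Spec (.of (MvPolynomial (Fin 5) k ⧸ Ideal.span {f}))).fromSpecStalk v)) ≠ ⊥ ∧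
      ((((affineBlowup.idealSheaf (Ideal.span (Set.range fun j : Fin 5 => Ideal.Quotient.mk (Ideal.span {f}) (X j)))).comap
        ((Spec (.of (MvPolynomial (Fin 5) k ⧸ Ideal.span {f}))).fromSpecStalk v)).support :
          Set (Spec ((Spec (.of (MvPolynomial (Fin 5) k ⧸ Ideal.span {f}))).presheaf.stalk v))) ⊆
        (Scheme.regularLocus (Spec ((Spec (.of (MvPolynomial (Fin 5) k ⧸ Ideal.span {f}))).presheaf.stalk v)))ᶜ) ∧
      (∀ s : S', g.base s ≠ closedPoint _ → s ∈ Scheme.regularLocus S') ∧ (∀ s : S', CMCl (S'.presheaf.stalk s))) ∧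
    (∃ s : S', g.base s = closedPoint _ ∧ ¬ FullCl p (S'.presheaf.stalk s)) ∧
    (∃ 𝓚 : S'.IdealSheafData, 𝓚 ≠ ⊥ ∧ (∀ s ∈ (𝓚.support : Set S'), g.base s = closedPoint _) ∧
      ∀ (S'' : Scheme.{0}) (π : S'' ⟶ S'), IsBlowup π 𝓚 → ∀ s : S'', FullCl p (S''.presheaf.stalk s)) :=
  BrieskornPhamRowOfF108.brieskornPhamRow_of_F108Consumable k p (F108Consumable_holds k 5) c a₀ a₁ a₂ a₃ hc h₀ h₀₁ h₀₂ h₀₃ ha₀ ha₁ ha₂ ha₃ hab f hf v hv S' g hg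

/-- **The Brieskorn–Pham row, FIVE-FLOOR form, unconditional** (no ordering of the exponents). (✓p683828 with `F108Consumable_holds`.) [OURS · unconditional] -/
theorem brieskornPhamRow_fiveFloor (p : ℕ) [Fact p.Prime] [IsAlgClosed k] [CharP k p]
    (c a₀ a₁ a₂ a₃ : ℕ) (hc : 2 ≤ c) (h₀ : c < a₀) (h₁ : c < a₁) (h₂ : c < a₂) (h₃ : c < a₃)
    (ha₀ : ((a₀ : ℕ) : k) ≠ 0) (ha₁ : ((a₁ : ℕ) : k) ≠ 0) (ha₂ : ((a₂ : ℕ) : k) ≠ 0) (ha₃ : ((a₃ : ℕ) : k) ≠ 0)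
    (hΦ : (p - 1) / c + (p - 1) / (a₀ - c) + (p - 1) / a₁ + (p - 1) / a₂ + (p - 1) / a₃ < p - 1)
    (f : MvPolynomial (Fin 5) k) (hf : f = X 4 ^ c + X 0 ^ a₀ + X 1 ^ a₁ + X 2 ^ a₂ + X 3 ^ a₃)
    (v : Spec (.of (MvPolynomial (Fin 5) k ⧸ Ideal.span {f})))
    (hv : v.asIdeal = Ideal.span (Set.range (fun j : Fin 5 => Ideal.Quotient.mk (Ideal.span {f}) (X j))))
    (S' : Scheme.{0}) (g : S' ⟶ Spec ((Spec (.of (MvPolynomial (Fin 5) k ⧸ Ideal.span {f}))).presheaf.stalk v))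
    (hg : IsBlowup g ((affineBlowup.idealSheaf (Ideal.span (Set.range (fun j : Fin 5 => Ideal.Quotient.mk (Ideal.span {f}) (X j))))).comap ((Spec (.of (MvPolynomial (Fin 5) k ⧸ Ideal.span {f}))).fromSpecStalk v))) :
    (((affineBlowup.idealSheaf (Ideal.span (Set.range fun j : Fin 5 => Ideal.Quotient.mk (Ideal.span {f}) (X j)))).comap
        ((Spec (.of (MvPolynomial (Fin 5) k ⧸ Ideal.span {f}))).fromSpecStalk v)) ≠ ⊥ ∧
      ((((affineBlowup.idealSheaf (Ideal.span (Set.range fun j : Fin 5 => Ideal.Quotient.mk (Ideal.span {f}) (X j)))).comap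
        ((Spec (.of (MvPolynomial (Fin 5) k ⧸ Ideal.span {f}))).fromSpecStalk v)).support :
          Set (Spec ((Spec (.of (MvPolynomial (Fin 5) k ⧸ Ideal.span {f}))).presheaf.stalk v))) ⊆
        (Scheme.regularLocus (Spec ((Spec (.of (MvPolynomial (Fin 5) k ⧸ Ideal.span {f}))).presheaf.stalk v)))ᶜ) ∧
      (∀ s : S', g.base s ≠ closedPoint _ → s ∈ Scheme.regularLocus S') ∧ (∀ s : S', CMCl (S'.presheaf.stalk s))) ∧
    (∃ s : S', g.base s = closedPoint _ ∧ ¬ FullCl p (S'.presheaf.stalk s)) ∧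
    (∃ 𝓚 : S'.IdealSheafData, 𝓚 ≠ ⊥ ∧ (∀ s ∈ (𝓚.support : Set S'), g.base s = closedPoint _) ∧
      ∀ (S'' : Scheme.{0}) (π : S'' ⟶ S'), IsBlowup π 𝓚 → ∀ s : S'', FullCl p (S''.presheaf.stalk s)) :=
  BrieskornPhamMultiChart.brieskornPhamRow_of_F108Consumable_of_fiveFloor k p (F108Consumable_holds k 5) c a₀ a₁ a₂ a₃ hc h₀ h₁ h₂ h₃ ha₀ ha₁ ha₂ ha₃ hΦ f hf v hv S' g hg

/-- **The diagonal double-point family `z² + Σx_j^a` at EVERY prime, unconditional** (`k = k̄`; `a ≥ 5`, `a ≠ 0` in `k` — at `p = 2` these are wild double points). (✓p683460 §4 with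
`F108Consumable_holds`.) [OURS · unconditional] -/
theorem diagonalRow_allP (p : ℕ) [Fact p.Prime] [IsAlgClosed k] [CharP k p] (a : ℕ) (ha5 : 5 ≤ a) (haK : ((a : ℕ) : k) ≠ 0) (f : MvPolynomial (Fin 5) k)
    (hf : f = X 4 ^ 2 + X 0 ^ a + X 1 ^ a + X 2 ^ a + X 3 ^ a)
    (v : Spec (.of (MvPolynomial (Fin 5) k ⧸ Ideal.span {f})))
    (hv : v.asIdeal = Ideal.span (Set.range (fun j : Fin 5 => Ideal.Quotient.mk (Ideal.span {f}) (X j))))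
    (S' : Scheme.{0}) (g : S' ⟶ Spec ((Spec (.of (MvPolynomial (Fin 5) k ⧸ Ideal.span {f}))).presheaf.stalk v))
    (hg : IsBlowup g ((affineBlowup.idealSheaf (Ideal.span (Set.range (fun j : Fin 5 => Ideal.Quotient.mk (Ideal.span {f}) (X j))))).comap ((Spec (.of (MvPolynomial (Fin 5) k ⧸ Ideal.span {f}))).fromSpecStalk v))) :
    (((affineBlowup.idealSheaf (Ideal.span (Set.range fun j : Fin 5 => Ideal.Quotient.mk (Ideal.span {f}) (X j)))).comap
        ((Spec (.of (MvPolynomial (Fin 5) k ⧸ Ideal.span {f}))).fromSpecStalk v)) ≠ ⊥ ∧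
      ((((affineBlowup.idealSheaf (Ideal.span (Set.range fun j : Fin 5 => Ideal.Quotient.mk (Ideal.span {f}) (X j)))).comap
        ((Spec (.of (MvPolynomial (Fin 5) k ⧸ Ideal.span {f}))).fromSpecStalk v)).support :
          Set (Spec ((Spec (.of (MvPolynomial (Fin 5) k ⧸ Ideal.span {f}))).presheaf.stalk v))) ⊆
        (Scheme.regularLocus (Spec ((Spec (.of (MvPolynomial (Fin 5) k ⧸ Ideal.span {f}))).presheaf.stalk v)))ᶜ) ∧
      (∀ s : S', g.base s ≠ closedPoint _ → s ∈ Scheme.regularLocus S') ∧ (∀ s : S', CMCl (S'.presheaf.stalk s))) ∧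
    (∃ s : S', g.base s = closedPoint _ ∧ ¬ FullCl p (S'.presheaf.stalk s)) ∧
    (∃ 𝓚 : S'.IdealSheafData, 𝓚 ≠ ⊥ ∧ (∀ s ∈ (𝓚.support : Set S'), g.base s = closedPoint _) ∧
      ∀ (S'' : Scheme.{0}) (π : S'' ⟶ S'), IsBlowup π 𝓚 → ∀ s : S'', FullCl p (S''.presheaf.stalk s)) :=
  BrieskornPhamRowOfF108.diagonalRow_of_F108Consumable' k p (F108Consumable_holds k 5) a ha5 haK f hf v hv S' g hg

/-- ★ **BED W `z³ + x⁴ + y⁵ + u⁵ + t⁷` THROUGH THE CLASS ROUTE, UNCONDITIONAL** (`k = k̄` of characteristic 3): LEGAL ∧ NOT FULL ∧ CURED for every blowing up along the point floor — a second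
proof of ✓p660468's row (that one by cells over any field of characteristic 3), here by the Brieskorn–Pham five-floor theorem + `F108Consumable_holds`. [OURS · unconditional] -/
theorem bedW_row_classRoute [IsAlgClosed k] [CharP k 3] (f : MvPolynomial (Fin 5) k) (hf : f = X 4 ^ 3 + X 0 ^ 4 + X 1 ^ 5 + X 2 ^ 5 + X 3 ^ 7)
    (v : Spec (.of (MvPolynomial (Fin 5) k ⧸ Ideal.span {f})))
    (hv : v.asIdeal = Ideal.span (Set.range (fun j : Fin 5 => Ideal.Quotient.mk (Ideal.span {f}) (X j))))
    (S' : Scheme.{0}) (g : S' ⟶ Spec ((Spec (.of (MvPolynomial (Fin 5) k ⧸ Ideal.span {f}))).presheaf.stalk v))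
    (hg : IsBlowup g ((affineBlowup.idealSheaf (Ideal.span (Set.range (fun j : Fin 5 => Ideal.Quotient.mk (Ideal.span {f}) (X j))))).comap ((Spec (.of (MvPolynomial (Fin 5) k ⧸ Ideal.span {f}))).fromSpecStalk v))) :
    (((affineBlowup.idealSheaf (Ideal.span (Set.range fun j : Fin 5 => Ideal.Quotient.mk (Ideal.span {f}) (X j)))).comap
        ((Spec (.of (MvPolynomial (Fin 5) k ⧸ Ideal.span {f}))).fromSpecStalk v)) ≠ ⊥ ∧
      ((((affineBlowup.idealSheaf (Ideal.span (Set.range fun j : Fin 5 => Ideal.Quotient.mk (Ideal.span {f}) (X j)))).comap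
        ((Spec (.of (MvPolynomial (Fin 5) k ⧸ Ideal.span {f}))).fromSpecStalk v)).support :
          Set (Spec ((Spec (.of (MvPolynomial (Fin 5) k ⧸ Ideal.span {f}))).presheaf.stalk v))) ⊆
        (Scheme.regularLocus (Spec ((Spec (.of (MvPolynomial (Fin 5) k ⧸ Ideal.span {f}))).presheaf.stalk v)))ᶜ) ∧
      (∀ s : S', g.base s ≠ closedPoint _ → s ∈ Scheme.regularLocus S') ∧ (∀ s : S', CMCl (S'.presheaf.stalk s))) ∧
    (∃ s : S', g.base s = closedPoint _ ∧ ¬ FullCl 3 (S'.presheaf.stalk s)) ∧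
    (∃ 𝓚 : S'.IdealSheafData, 𝓚 ≠ ⊥ ∧ (∀ s ∈ (𝓚.support : Set S'), g.base s = closedPoint _) ∧
      ∀ (S'' : Scheme.{0}) (π : S'' ⟶ S'), IsBlowup π 𝓚 → ∀ s : S'', FullCl 3 (S''.presheaf.stalk s)) :=
  BrieskornPhamMultiChart.bedW_row_of_F108Consumable k (F108Consumable_holds k 5) f hf v hv S' g hg

end Summit.ResolutionOfSingularities.ResolutionOfSingularities.Theorems.FInjectiveMacaulayfication.F108Unconditional

end
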